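import Mathlib.LinearAlgebra.Matrix.Transvection
import Mathlib.Algebra.MvPolynomial.Basic
import Mathlib.Data.Complex.Basic

/-! # Crux `UniqStep` (stmt-ValiantsHypothesis-17834), line `Sketch` (phase 2: the purified source twist) — stub `stub_elementaryOps`:
# the purifying elementary operations

WHAT. Let `n = k + 3`, `R := MvPolynomial (Fin n × Fin n) ℂ` and index rows and columns by
`Finset (Fin n)` (the vertices of Grenet's hypercube). The purified source twist of Grenet's matrix is
`K_full := P · (1 − Grenet.adj ℂ n) · EQ` with the two explicit products of elementary matrices
* `P  := diag(−1 at ∅) · T(∅,{0,1},−1) · T({1},∅,−1) · T({1},{0,2},1) · T({0},{1,2},1) · (1 + Σ_{l ≥ 2} E_{{l},{0,1}})`,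
* `EQ := T({0},{1,2},−X(1,0)) · T({1},{1,2},X(0,0)) · T({0},{1,2},−1) · T({0,2},{1},−1) · diag(−1 at singletons)`
(`T(i,j,c) = Matrix.transvection i j c = 1 + Matrix.single i j c`). This file proves the four
bookkeeping facts about them (`stub_elementaryOps`):
1. the ROW ACTION of `P`: `(P * M) S T` is `−M ∅ T + M {0,1} T` at `S = ∅`, `M {0} T + M {1,2} T` at
   `S = {0}`, `−M ∅ T + M {1} T + M {0,2} T` at `S = {1}`, `M S T + M {0,1} T` at the other singletons,
   and `M S T` elsewhere (peel the factors from the right with `Matrix.transvection_mul_apply_*`);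
2. `det P = −1` (the transvections have determinant `1`, the last factor is a product of commuting
   transvections, `det_one_add_sum_single`, and the sign diagonal has determinant `−1`);
3. the COLUMN ACTION of `EQ`: `(M * EQ) S T` is `M S {1,2} − X(1,0) M S {0} + X(0,0) M S {1} − M S {0}`
   at `T = {1,2}`, `−M S {1} + M S {0,2}` at `T = {1}`, `−M S T` at the other singletons, `M S T`
   elsewhere (`Matrix.mul_transvection_apply_*`);
4. `det EQ = (−1)^(k+3)` (there are `k + 3` singletons, `prod_ite_card_eq_one`).

WHY. Stub V1 of the line: the composition `UniqStep_of` feeds (1)–(4) to the cell computation of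
`K_full` (V3a, V3b) and to the adjugate computation `adj(K_full)_{∅,univ} = (−1)^k per_n` (V4), which
make the signed `(univ, ∅)`-minor of `K_full` a second, inequivalent, honest optimal projection of the
permanent — so the antecedent `Uniq n` of the crux fails.

SOURCE. This session's construction (computations `compute/purify_*.py`); the matrix being purified is
that of B. Grenet, *An upper bound for the permanent versus determinant problem* (2011), and the `(3,7)`
twist is from J. Hüttenhain, C. Ikenmeyer, *Binary determinantal complexity*, Linear Algebra Appl. 504
(2016). The lemmas here are elementary linear algebra over a commutative ring.
-/

-- D-0017 layout: Sub = Summit for this single-conjunct summit, so the namespace repeats a component.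
set_option linter.dupNamespace false

namespace Summit.ValiantsHypothesis.ValiantsHypothesis.Theorems.ProjectionStabilityUniqStep

open MvPolynomial
open scoped BigOperators Matrix

noncomputable section

/-! ### General helpers -/

/-- A sum of elementary matrices `E_{f b, j}` off the row `j` gives a unipotent matrix
`1 + Σ_b E_{f b, j}` (a product of commuting transvections), of determinant `1`. [folklore] -/
theorem det_one_add_sum_single {n β R : Type*} [Fintype n] [DecidableEq n] [DecidableEq β]
    [CommRing R] (s : Finset β) (f : β → n) (j : n) (hf : ∀ b ∈ s, f b ≠ j) :
    (1 + ∑ b ∈ s, Matrix.single (f b) j (1 : R)).det = 1 := by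
  induction s using Finset.induction_on with
  | empty => simp
  | insert a s ha ih =>
    have hf' : ∀ b ∈ s, f b ≠ j := fun b hb => hf b (Finset.mem_insert_of_mem hb)
    have h0 : ∑ b ∈ s, Matrix.single (f a) j (1 : R) * Matrix.single (f b) j (1 : R) = 0 :=
      Finset.sum_eq_zero fun b hb => Matrix.single_mul_single_of_ne _ _ _ _ (hf' b hb).symm _
    have key : (1 + ∑ b ∈ insert a s, Matrix.single (f b) j (1 : R)) =
        Matrix.transvection (f a) j 1 * (1 + ∑ b ∈ s, Matrix.single (f b) j (1 : R)) := by
      rw [Finset.sum_insert ha, Matrix.transvection, add_mul, one_mul, mul_add, mul_one,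
        Finset.mul_sum, h0, add_zero]
      abel
    rw [key, Matrix.det_mul, Matrix.det_transvection_of_ne _ _ (hf a (Finset.mem_insert_self a s)),
      one_mul, ih hf']

/-- Row action of the last factor `1 + Σ_{l ≥ 2} E_{{l},{0,1}}` of `P`: it adds the row `{0,1}` to every
singleton row `{l}` with `l ≥ 2`, i.e. to every singleton row other than `{0}` and `{1}`. [folklore] -/
theorem one_add_sum_single_mul_apply (k : ℕ) {R : Type*} [CommRing R]
    (N : Matrix (Finset (Fin (k + 3))) (Finset (Fin (k + 3))) R) (S T : Finset (Fin (k + 3))) :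
    ((1 + ∑ l ∈ Finset.filter (fun l : Fin (k + 3) => 2 ≤ l.val) Finset.univ,
        Matrix.single ({l} : Finset (Fin (k + 3))) ({0, 1} : Finset (Fin (k + 3))) (1 : R)) * N) S T =
      N S T + if S.card = 1 ∧ S ≠ {0} ∧ S ≠ {1} then N {0, 1} T else 0 := by
  rw [add_mul, one_mul, Matrix.add_apply, Finset.sum_mul, Matrix.sum_apply]
  congr 1
  split_ifs with h
  · obtain ⟨hc, h0, h1⟩ := h
    obtain ⟨a, rfl⟩ := Finset.card_eq_one.mp hc
    -- `a ≠ 0, 1`, so `2 ≤ a.val` (the values of `0, 1 : Fin (k + 3)` are `0, 1` by `rfl`)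
    have h0' : a.val ≠ 0 := Fin.val_ne_of_ne (j := 0) fun e => h0 (by rw [e])
    have h1' : a.val ≠ 1 := Fin.val_ne_of_ne (j := 1) fun e => h1 (by rw [e])
    have ha : a ∈ Finset.filter (fun l : Fin (k + 3) => 2 ≤ l.val) Finset.univ := by
      rw [Finset.mem_filter]
      exact ⟨Finset.mem_univ a, by omega⟩
    rw [Finset.sum_eq_single_of_mem a ha fun b _ hb =>
      Matrix.single_mul_apply_of_ne _ _ _ _ _ (Finset.singleton_injective.ne hb.symm) _]
    rw [Matrix.single_mul_apply_same, one_mul]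
  · refine Finset.sum_eq_zero fun l hl => Matrix.single_mul_apply_of_ne _ _ _ _ _ ?_ _
    rintro rfl
    have hl' : 2 ≤ l.val := (Finset.mem_filter.mp hl).2
    refine h ⟨Finset.card_singleton l, ?_, ?_⟩
    · intro e
      rw [Finset.singleton_inj] at e
      subst e
      exact absurd hl' (show ¬ 2 ≤ (0 : ℕ) by decide)
    · intro e
      rw [Finset.singleton_inj] at e
      subst e
      exact absurd hl' (show ¬ 2 ≤ (1 : ℕ) by decide)

/-- The sign diagonal `diag(−1 at singletons)` on `Finset (Fin n)` has determinant `(−1)^n`: there are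
`n` singletons. [folklore] -/
theorem prod_ite_card_eq_one (n : ℕ) {R : Type*} [CommRing R] :
    (∏ T : Finset (Fin n), if T.card = 1 then (-1 : R) else 1) = (-1) ^ n := by
  rw [Finset.prod_ite, Finset.prod_const_one, mul_one, Finset.prod_const]
  congr 1
  have h : Finset.filter (fun T : Finset (Fin n) => T.card = 1) Finset.univ =
      Finset.powersetCard 1 Finset.univ := by
    ext T
    simp [Finset.mem_powersetCard]
  rw [h, Finset.card_powersetCard, Finset.card_univ, Fintype.card_fin, Nat.choose_one_right]

/-! ### The stub -/

/-- **STUB V1** of line `Sketch` (phase 2) of crux `UniqStep`: the purifying elementary operations.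
Row action and determinant of
`P = diag(−1 at ∅) · T(∅,{0,1},−1) · T({1},∅,−1) · T({1},{0,2},1) · T({0},{1,2},1) · (1 + Σ_{l ≥ 2} E_{{l},{0,1}})`,
column action and determinant of
`EQ = T({0},{1,2},−X(1,0)) · T({1},{1,2},X(0,0)) · T({0},{1,2},−1) · T({0,2},{1},−1) · diag(−1 at singletons)`
(products of transvections and sign diagonals). [folklore] -/
theorem stub_elementaryOps :
    ∀ k : ℕ,
    (∀ (M : Matrix (Finset (Fin (k + 3))) (Finset (Fin (k + 3))) (MvPolynomial (Fin (k + 3) × Fin (k + 3)) ℂ))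
        (S T : Finset (Fin (k + 3))),
      (Matrix.diagonal (fun S : Finset (Fin (k + 3)) =>
            if S = ∅ then (-1 : MvPolynomial (Fin (k + 3) × Fin (k + 3)) ℂ) else 1) *
          Matrix.transvection (∅ : Finset (Fin (k + 3))) {0, 1} (-1) *
          Matrix.transvection ({1} : Finset (Fin (k + 3))) ∅ (-1) *
          Matrix.transvection ({1} : Finset (Fin (k + 3))) {0, 2} 1 *
          Matrix.transvection ({0} : Finset (Fin (k + 3))) {1, 2} 1 *
          (1 + ∑ l ∈ Finset.filter (fun l : Fin (k + 3) => 2 ≤ l.val) Finset.univ,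
            Matrix.single ({l} : Finset (Fin (k + 3))) ({0, 1} : Finset (Fin (k + 3)))
              (1 : MvPolynomial (Fin (k + 3) × Fin (k + 3)) ℂ)) * M : Matrix (Finset (Fin (k + 3))) (Finset (Fin (k + 3))) (MvPolynomial (Fin (k + 3) × Fin (k + 3)) ℂ)) S T =
        if S = ∅ then -M ∅ T + M {0, 1} T
        else if S = {0} then M {0} T + M {1, 2} T
        else if S = {1} then -M ∅ T + M {1} T + M {0, 2} T
        else if S.card = 1 then M S T + M {0, 1} T
        else M S T) ∧
    (Matrix.diagonal (fun S : Finset (Fin (k + 3)) =>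
            if S = ∅ then (-1 : MvPolynomial (Fin (k + 3) × Fin (k + 3)) ℂ) else 1) *
          Matrix.transvection (∅ : Finset (Fin (k + 3))) {0, 1} (-1) *
          Matrix.transvection ({1} : Finset (Fin (k + 3))) ∅ (-1) *
          Matrix.transvection ({1} : Finset (Fin (k + 3))) {0, 2} 1 *
          Matrix.transvection ({0} : Finset (Fin (k + 3))) {1, 2} 1 *
          (1 + ∑ l ∈ Finset.filter (fun l : Fin (k + 3) => 2 ≤ l.val) Finset.univ,
            Matrix.single ({l} : Finset (Fin (k + 3))) ({0, 1} : Finset (Fin (k + 3)))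
              (1 : MvPolynomial (Fin (k + 3) × Fin (k + 3)) ℂ))).det = -1 ∧
    (∀ (M : Matrix (Finset (Fin (k + 3))) (Finset (Fin (k + 3))) (MvPolynomial (Fin (k + 3) × Fin (k + 3)) ℂ))
        (S T : Finset (Fin (k + 3))),
      (M * (Matrix.transvection ({0} : Finset (Fin (k + 3))) {1, 2} (-(X (1, 0))) *
          Matrix.transvection ({1} : Finset (Fin (k + 3))) {1, 2} (X (0, 0)) *
          Matrix.transvection ({0} : Finset (Fin (k + 3))) {1, 2} (-1) *
          Matrix.transvection ({0, 2} : Finset (Fin (k + 3))) {1} (-1) *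
          Matrix.diagonal (fun T : Finset (Fin (k + 3)) =>
            if T.card = 1 then (-1 : MvPolynomial (Fin (k + 3) × Fin (k + 3)) ℂ) else 1)) : Matrix (Finset (Fin (k + 3))) (Finset (Fin (k + 3))) (MvPolynomial (Fin (k + 3) × Fin (k + 3)) ℂ)) S T =
        if T = {1, 2} then M S {1, 2} - X (1, 0) * M S {0} + X (0, 0) * M S {1} - M S {0}
        else if T = {1} then -M S {1} + M S {0, 2}
        else if T.card = 1 then -M S T
        else M S T) ∧
    (Matrix.transvection ({0} : Finset (Fin (k + 3))) {1, 2} (-(X (1, 0))) *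
          Matrix.transvection ({1} : Finset (Fin (k + 3))) {1, 2} (X (0, 0)) *
          Matrix.transvection ({0} : Finset (Fin (k + 3))) {1, 2} (-1) *
          Matrix.transvection ({0, 2} : Finset (Fin (k + 3))) {1} (-1) *
          Matrix.diagonal (fun T : Finset (Fin (k + 3)) =>
            if T.card = 1 then (-1 : MvPolynomial (Fin (k + 3) × Fin (k + 3)) ℂ) else 1)).det =
      (-1) ^ (k + 3) := by
  intro k
  -- `0, 1, 2` are distinct in `Fin (k + 3)` (their values are `0, 1, 2` by `rfl`)
  have h01 : (0 : Fin (k + 3)) ≠ 1 := Fin.ne_of_val_ne (show (0 : ℕ) ≠ 1 by decide)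
  have h02 : (0 : Fin (k + 3)) ≠ 2 := Fin.ne_of_val_ne (show (0 : ℕ) ≠ 2 by decide)
  have h12 : (1 : Fin (k + 3)) ≠ 2 := Fin.ne_of_val_ne (show (1 : ℕ) ≠ 2 by decide)
  -- the index sets involved are pairwise distinct (a witness in one but not in the other)
  have n_e_0 : (∅ : Finset (Fin (k + 3))) ≠ {0} := (Finset.singleton_ne_empty 0).symm
  have n_e_1 : (∅ : Finset (Fin (k + 3))) ≠ {1} := (Finset.singleton_ne_empty 1).symm
  have n_e_01 : (∅ : Finset (Fin (k + 3))) ≠ {0, 1} := (Finset.insert_ne_empty 0 {1}).symm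
  have n_0_1 : ({0} : Finset (Fin (k + 3))) ≠ {1} :=
    ne_of_mem_of_not_mem' (a := 0) (by simp) (by simp [h01])
  have n_01_0 : ({0, 1} : Finset (Fin (k + 3))) ≠ {0} :=
    ne_of_mem_of_not_mem' (a := 1) (by simp) (by simp [h01.symm])
  have n_01_1 : ({0, 1} : Finset (Fin (k + 3))) ≠ {1} :=
    ne_of_mem_of_not_mem' (a := 0) (by simp) (by simp [h01])
  have n_02_0 : ({0, 2} : Finset (Fin (k + 3))) ≠ {0} :=
    ne_of_mem_of_not_mem' (a := 2) (by simp) (by simp [h02.symm])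
  have n_1_02 : ({1} : Finset (Fin (k + 3))) ≠ {0, 2} :=
    ne_of_mem_of_not_mem' (a := 1) (by simp) (by simp [h01.symm, h12])
  have n_0_12 : ({0} : Finset (Fin (k + 3))) ≠ {1, 2} :=
    ne_of_mem_of_not_mem' (a := 0) (by simp) (by simp [h01, h02])
  have n_12_1 : ({1, 2} : Finset (Fin (k + 3))) ≠ {1} :=
    ne_of_mem_of_not_mem' (a := 2) (by simp) (by simp [h12.symm])
  have n_02_12 : ({0, 2} : Finset (Fin (k + 3))) ≠ {1, 2} :=
    ne_of_mem_of_not_mem' (a := 0) (by simp) (by simp [h01, h02])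
  have c01 : ({0, 1} : Finset (Fin (k + 3))).card = 2 := Finset.card_pair h01
  have c02 : ({0, 2} : Finset (Fin (k + 3))).card = 2 := Finset.card_pair h02
  have c12 : ({1, 2} : Finset (Fin (k + 3))).card = 2 := Finset.card_pair h12
  refine ⟨fun M S T => ?_, ?_, fun M S T => ?_, ?_⟩
  · -- (1) row action of `P`: peel the factors from the right
    simp only [Matrix.mul_assoc]
    set N := (1 + ∑ l ∈ Finset.filter (fun l : Fin (k + 3) => 2 ≤ l.val) Finset.univ,
            Matrix.single ({l} : Finset (Fin (k + 3))) ({0, 1} : Finset (Fin (k + 3)))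
              (1 : MvPolynomial (Fin (k + 3) × Fin (k + 3)) ℂ)) * M with hN
    have hN' : ∀ A B, N A B = M A B + if A.card = 1 ∧ A ≠ {0} ∧ A ≠ {1} then M {0, 1} B else 0 :=
      fun A B => by rw [hN]; exact one_add_sum_single_mul_apply k M A B
    by_cases hS0 : S = ∅
    · subst hS0
      simp [Matrix.transvection_mul_apply_of_ne, hN', n_e_0, n_e_1, n_01_0, n_01_1, c01]
      ring
    · by_cases hS1 : S = {0}
      · subst hS1
        simp [Matrix.transvection_mul_apply_of_ne, hN', hS0, n_0_1, c12]
      · by_cases hS2 : S = {1}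
        · subst hS2
          simp [Matrix.transvection_mul_apply_of_ne, hN', hS0, hS1, n_e_0, n_e_1, n_02_0, c02]
          ring
        · by_cases hS3 : S.card = 1
          · simp [Matrix.transvection_mul_apply_of_ne, hN', hS0, hS1, hS2, hS3]
          · simp [Matrix.transvection_mul_apply_of_ne, hN', hS0, hS1, hS2, hS3]
  · -- (2) `det P = -1`
    have hF : ∀ l ∈ Finset.filter (fun l : Fin (k + 3) => 2 ≤ l.val) Finset.univ,
        ({l} : Finset (Fin (k + 3))) ≠ {0, 1} := fun l _ h => by
      have h' := congrArg Finset.card h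
      rw [Finset.card_singleton, c01] at h'
      omega
    have hP3 : (1 + ∑ l ∈ Finset.filter (fun l : Fin (k + 3) => 2 ≤ l.val) Finset.univ,
        Matrix.single ({l} : Finset (Fin (k + 3))) ({0, 1} : Finset (Fin (k + 3)))
          (1 : MvPolynomial (Fin (k + 3) × Fin (k + 3)) ℂ)).det = 1 :=
      det_one_add_sum_single _ (fun l => ({l} : Finset (Fin (k + 3)))) _ hF
    simp [Matrix.det_mul, hP3, n_e_01, n_e_1.symm, n_1_02, n_0_12]
  · -- (3) column action of `EQ`: peel the factors from the left
    simp only [← Matrix.mul_assoc]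
    by_cases hT12 : T = {1, 2}
    · subst hT12
      simp [Matrix.mul_transvection_apply_of_ne, n_12_1, n_12_1.symm, n_0_12, c12]
      ring
    · rw [if_neg hT12]
      by_cases hT1 : T = {1}
      · subst hT1
        simp [Matrix.mul_transvection_apply_of_ne, n_12_1.symm, n_02_12]
        ring
      · rw [if_neg hT1]
        simp [Matrix.mul_transvection_apply_of_ne, hT12, hT1]
  · -- (4) `det EQ = (-1) ^ (k + 3)`
    simp [Matrix.det_mul, n_0_12, n_12_1.symm, n_1_02.symm, prod_ite_card_eq_one]

end

end Summit.ValiantsHypothesis.ValiantsHypothesis.Theorems.ProjectionStabilityUniqStep
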